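import Summits.QuantumFields.BalabanUV.T4Continuum.Support.NE7CommutingLogDerivative
import Summits.QuantumFields.BalabanUV.T4Continuum.Support.NE7FlatAverageCurlCommutation
import Summits.QuantumFields.BalabanUV.T4Continuum.Support.NE7ConstantFluxBackground
import HarnessLib

/-!
# NE7CommutingPushForward — IN THE U(1) (COMMUTING) SECTOR THE LINEARISED BLOCK AVERAGE AT EVERY SMALL BACKGROUND IS BAŁABAN'S FLAT `T`:
# `pushDir L V ψ = Tside L ψ`, hence `D(coord L M V)(0) = D(coord L M 1)(0)` and `levelQ' L N j V = levelQ' L N j 1` — the multi-level constraint differential is BACKGROUND-INDEPENDENT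

Lineage `b2b-balaban-t4-ne7-p1` (CRUX PROVER NE7 #1 = OWNER of BINDER row NE7), generation 116 — third brick of ROAD-G116 §7 (G-ab).  When ALL matrix values commute
(`hcomm : ∀ a b, Commute a b` — the U(1) sector `card n = 1`, `commute_all_of_card_eq_one`), every `Ad` is the identity and along `V e^{sψ}`:
`V e^{sψ}(Γ) = V(Γ)·e^{s ψ(Γ)}` (`val_hol_vary`), the loop variables of (42) are `W_{c,x}·e^{s ψ(loop)}` (`val_Wcx_vary`), so by ✓ `NE7CommutingLogDerivative.hasDerivAt_mlog_mul_exp_smul`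
`d/ds|₀ log W_{c,x}[V e^{sψ}] = ψ(loop)` (`mlogDeriv_comm`, radius `‖W_{c,x} − 1‖ ≤ 1/4`), `X_c′ = X̂_c(ψ)` (`XavgDeriv_comm`), the linearised transport is the plain contour sum
(`dhol_comm`), the Duhamel kernel is the identity (✓ `jexp_of_commute`), and therefore **`sideDeriv_comm`** ∕ **`pushDir_comm`**: `pushDir L V ψ q κ = Tside L ψ q κ` — the same as at the
flat background (✓ `BlockAveragePushDirSplit.pushDir_flat`).  Consequences: **`fderiv_coord_comm`** (`D(coord_id L M V)(0) = D(coord_id L M 1)(0)` as continuous linear maps) and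
**`levelQ'_comm_eq_flat`** (`levelQ' L N j V = levelQ' L N j 1` whenever every iterated average `(cavg L)^[i] V`, `i ≤ j`, has loop radius `≤ 1/4`): in the abelian sector the
constraint differential of the bordered Hessian (✓ `NE7MinActHessianHessForm`) IS the flat one, at every level.  [folklore]; 0 def, 0 sorry.
HONEST FRAMING: lattice kinematics under an explicit commutation HYPOTHESIS; nothing about Bałaban's minimisers; NOT NE7 as a spine node; spine 0∕9; NOT infinite volume, NOT mass
gap, NOT BetaPertH, NOT Clay.
-/

set_option autoImplicit false

open scoped BigOperators Matrix Matrix.Norms.L2Operator Topology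
open NormedSpace Finset Filter

namespace Summit.QuantumFields.BalabanUV.T4Continuum.NE7CommutingPushForward

open Literature.MathematicalPhysics.QuantumFieldTheory.Balaban1983to89
open B7Prop1Explicit B7Prop2Explicit MatrixLog
open T4AveragingDeficitWall (Ad vary)
open AveragingDeficitTorusChart (TDir chartDir)
open AveragingDeficitChartCalculus (coord cavg fderiv_coord_apply)
open AveragingDeficitTwoLevelPrep (skewSub twoLevelQ')
open AveragingDeficitMultiLevelPrep (tower levelQ' tower_ne_zero)
open AveragingDeficitTransport (dstep dhol)
open AveragingDeficitSideDeriv (jexp mlogDeriv XavgDeriv sideDeriv)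
open AveragingDeficitResidualPairing (pushDir)
open MinimalActionWitness (flatCfg)
open NE7ConstantFluxBackground (Ad_eq_of_commute)
open NE7CommutingLogDerivative (hasDerivAt_mlog_mul_exp_smul jexp_of_commute)
open NE7FlatAverageCurlCommutation (fderiv_coord_flatCfg_apply)
open NE3TangentFlatPush (cavg_flatCfg)

noncomputable section

variable {d : ℕ} {n : Type} [Fintype n] [DecidableEq n]

/-! ## §1 The U(1) sector: one colour index, everything commutes -/

omit [DecidableEq n] in
/-- With one colour index every two matrices commute. [folklore] -/
theorem commute_all_of_card_eq_one (h : Fintype.card n = 1) (a b : Matrix n n ℂ) : Commute a b := by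
  haveI : Subsingleton n := Fintype.card_le_one_iff_subsingleton.mp h.le
  refine Matrix.ext fun i j => ?_
  have hij : j = i := Subsingleton.elim _ _
  subst hij
  rw [Matrix.mul_apply, Matrix.mul_apply, Fintype.sum_subsingleton _ j, Fintype.sum_subsingleton _ j, mul_comm]

/-! ## §2 Transport along `V e^{sψ}` -/

section Comm

variable (hcomm : ∀ a b : Matrix n n ℂ, Commute a b)
include hcomm

/-- One letter: `(V e^{sψ})(l) = V(l)·e^{s·(±ψ)(l)}`. [folklore] -/
theorem val_stepHol_vary (V : Site d → Fin d → (Matrix n n ℂ)ˣ) (ψ : Site d → Fin d → Matrix n n ℂ) (s : ℝ) (x : Site d) (l : Letter d) :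
    ((stepHol (vary V ψ s) x l : (Matrix n n ℂ)ˣ) : Matrix n n ℂ) = ((stepHol V x l : (Matrix n n ℂ)ˣ) : Matrix n n ℂ) * exp ((s : ℂ) • stepA ψ x l) := by
  obtain ⟨μ, b⟩ := l
  cases b
  · simp only [stepHol, vary, stepA, Bool.false_eq_true, ↓reduceIte, mul_inv_rev, Units.val_mul, val_inv_expUnit, val_expUnit, smul_neg]
    exact (hcomm _ _).eq
  · simp only [stepHol, vary, stepA, ↓reduceIte, Units.val_mul, val_expUnit]

/-- **Abelian transport of a varied configuration**: `(V e^{sψ})(Γ) = V(Γ)·e^{s·ψ(Γ)}` along every word. [folklore] -/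
theorem val_hol_vary (V : Site d → Fin d → (Matrix n n ℂ)ˣ) (ψ : Site d → Fin d → Matrix n n ℂ) (s : ℝ) :
    ∀ (x : Site d) (w : List (Letter d)),
      ((hol (vary V ψ s) x w : (Matrix n n ℂ)ˣ) : Matrix n n ℂ) = ((hol V x w : (Matrix n n ℂ)ˣ) : Matrix n n ℂ) * exp ((s : ℂ) • asum ψ x w)
  | x, [] => by simp
  | x, l :: w => by
      letI : NormedAlgebra ℚ (Matrix n n ℂ) := NormedAlgebra.restrictScalars ℚ ℂ (Matrix n n ℂ)
      rw [hol_cons, hol_cons, asum_cons, Units.val_mul, Units.val_mul, val_stepHol_vary hcomm, val_hol_vary V ψ s (x + l.vec) w, smul_add,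
        exp_add_of_commute (hcomm _ _)]
      set A := ((stepHol V x l : (Matrix n n ℂ)ˣ) : Matrix n n ℂ)
      set B := ((hol V (x + l.vec) w : (Matrix n n ℂ)ˣ) : Matrix n n ℂ)
      set E₁ := exp ((s : ℂ) • stepA ψ x l)
      set E₂ := exp ((s : ℂ) • asum ψ (x + l.vec) w)
      rw [mul_assoc A E₁, ← mul_assoc E₁ B, (hcomm E₁ B).eq, mul_assoc B E₁, mul_assoc A B]

/-- **The loop variables of (42) along `V e^{sψ}`**: `W_{c,x}[V e^{sψ}] = W_{c,x}[V]·e^{s·ψ(Γ_{c,x} ∪ (−c))}`. [folklore] -/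
theorem val_Wcx_vary (L : ℕ) (V : Site d → Fin d → (Matrix n n ℂ)ˣ) (ψ : Site d → Fin d → Matrix n n ℂ) (s : ℝ) (q : Site d) (κ : Fin d) (r : Site d) :
    ((Wcx L (vary V ψ s) q κ r : (Matrix n n ℂ)ˣ) : Matrix n n ℂ)
      = ((Wcx L V q κ r : (Matrix n n ℂ)ˣ) : Matrix n n ℂ) * exp ((s : ℂ) • asum ψ q (gammaWord L κ r ++ seg κ (-(L : ℤ)))) := by
  rw [Wcx_eq_hol_loop, Wcx_eq_hol_loop, val_hol_vary hcomm]

/-! ## §3 The derivatives of the average in the commuting sector -/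

/-- **`d/ds|₀ log W_{c,x}[V e^{sψ}] = ψ(Γ_{c,x} ∪ (−c))`** (loop radius `≤ 1/4`). [folklore] -/
theorem mlogDeriv_comm (L : ℕ) (V : Site d → Fin d → (Matrix n n ℂ)ˣ) (ψ : Site d → Fin d → Matrix n n ℂ) (q : Site d) (κ : Fin d) (r : Site d)
    (hW : ‖((Wcx L V q κ r : (Matrix n n ℂ)ˣ) : Matrix n n ℂ) - 1‖ ≤ 1 / 4) :
    mlogDeriv L V ψ q κ r = asum ψ q (gammaWord L κ r ++ seg κ (-(L : ℤ))) := by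
  have hu : ‖((Wcx L V q κ r : (Matrix n n ℂ)ˣ) : Matrix n n ℂ) - 1‖ < 1 := by linarith
  have hlog : ‖mlog ((Wcx L V q κ r : (Matrix n n ℂ)ˣ) : Matrix n n ℂ)‖ < Real.log 2 := by
    have h1 := norm_mlog_le_two_mul (X := ((Wcx L V q κ r : (Matrix n n ℂ)ˣ) : Matrix n n ℂ)) (by linarith)
    have h2 := Real.log_two_gt_d9
    linarith
  have h := hasDerivAt_mlog_mul_exp_smul hu hlog (hcomm _ (asum ψ q (gammaWord L κ r ++ seg κ (-(L : ℤ)))))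
  have hfun : (fun s : ℝ => mlog ((Wcx L (vary V ψ s) q κ r : (Matrix n n ℂ)ˣ) : Matrix n n ℂ))
      = fun s : ℝ => mlog (((Wcx L V q κ r : (Matrix n n ℂ)ˣ) : Matrix n n ℂ) * exp ((s : ℂ) • asum ψ q (gammaWord L κ r ++ seg κ (-(L : ℤ))))) :=
    funext fun s => by rw [val_Wcx_vary hcomm]
  unfold mlogDeriv
  rw [hfun]
  exact h.deriv

/-- **`X_c′ = X̂_c(ψ)`**: the derivative of the exponent of (42) is the flat first-order term (loop radius `≤ 1/4` on the block). [folklore] -/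
theorem XavgDeriv_comm (L : ℕ) (V : Site d → Fin d → (Matrix n n ℂ)ˣ) (ψ : Site d → Fin d → Matrix n n ℂ) (q : Site d) (κ : Fin d)
    (hW : ∀ r : Fin d → Fin L, ‖((Wcx L V q κ (boxVec L r) : (Matrix n n ℂ)ˣ) : Matrix n n ℂ) - 1‖ ≤ 1 / 4) :
    XavgDeriv L V ψ q κ = Xhat L ψ q κ := by
  unfold XavgDeriv Xhat
  exact Finset.sum_congr rfl fun r _ => by rw [mlogDeriv_comm hcomm L V ψ q κ (boxVec L r) (hW r)]

/-- The linearised transport of one letter is the plain signed value. [folklore] -/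
theorem dstep_comm (V : Site d → Fin d → (Matrix n n ℂ)ˣ) (ψ : Site d → Fin d → Matrix n n ℂ) (x : Site d) (l : Letter d) :
    dstep V ψ x l = stepA ψ x l := by
  obtain ⟨μ, b⟩ := l
  cases b
  · simp only [dstep, stepA, Bool.false_eq_true, ↓reduceIte]
  · simp only [dstep, stepA, ↓reduceIte, Ad_eq_of_commute (hcomm _ _)]

/-- **The linearised transport is the plain contour sum**: `δ_ψ V (Γ) = ψ(Γ)`. [folklore] -/
theorem dhol_comm (V : Site d → Fin d → (Matrix n n ℂ)ˣ) (ψ : Site d → Fin d → Matrix n n ℂ) :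
    ∀ (x : Site d) (w : List (Letter d)), dhol V ψ x w = asum ψ x w
  | x, [] => by simp [dhol]
  | x, l :: w => by
      rw [dhol, asum_cons, dstep_comm hcomm, dhol_comm V ψ (x + l.vec) w, Ad_eq_of_commute (hcomm _ _)]

/-- **`δV̄(c) = T_c(ψ)`** in the commuting sector (loop radius `≤ 1/4`, `L ≥ 1`). [folklore] -/
theorem sideDeriv_comm {L : ℕ} (hL : 1 ≤ L) (V : Site d → Fin d → (Matrix n n ℂ)ˣ) (ψ : Site d → Fin d → Matrix n n ℂ) (q : Site d) (κ : Fin d)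
    (hW : ∀ r : Fin d → Fin L, ‖((Wcx L V q κ (boxVec L r) : (Matrix n n ℂ)ˣ) : Matrix n n ℂ) - 1‖ ≤ 1 / 4) :
    sideDeriv L V ψ q κ = Tside L ψ q κ := by
  unfold sideDeriv
  rw [XavgDeriv_comm hcomm L V ψ q κ hW, jexp_of_commute (hcomm _ _), dhol_comm hcomm, Ad_eq_of_commute (hcomm _ _), Xhat_eq L hL, sub_add_cancel]

/-- **THE PUSH-FORWARD OF (42) IN THE COMMUTING SECTOR IS THE FLAT `T`**: `pushDir L V ψ q κ = Tside L ψ q κ` (loop radius `≤ 1/4`, `L ≥ 1`). [folklore] -/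
theorem pushDir_comm {L : ℕ} (hL : 1 ≤ L) (V : Site d → Fin d → (Matrix n n ℂ)ˣ) (ψ : Site d → Fin d → Matrix n n ℂ) (q : Site d) (κ : Fin d)
    (hW : ∀ r : Fin d → Fin L, ‖((Wcx L V q κ (boxVec L r) : (Matrix n n ℂ)ˣ) : Matrix n n ℂ) - 1‖ ≤ 1 / 4) :
    pushDir L V ψ q κ = Tside L ψ q κ := by
  unfold pushDir
  rw [Ad_eq_of_commute (hcomm _ _), sideDeriv_comm hcomm hL V ψ q κ hW]

/-! ## §4 The constraint differentials are background-independent -/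

/-- **`D(coord_id L M V)(0) = D(coord_id L M 1)(0)`** in the commuting sector (loop radius `≤ 1/4` everywhere, `L ≥ 1`). [folklore] -/
theorem fderiv_coord_comm {L M : ℕ} [NeZero L] [NeZero M] [NeZero (L * M)] (V : Site d → Fin d → (Matrix n n ℂ)ˣ)
    (hW : ∀ (q : Site d) (κ : Fin d) (r : Fin d → Fin L), ‖((Wcx L V q κ (boxVec L r) : (Matrix n n ℂ)ˣ) : Matrix n n ℂ) - 1‖ ≤ 1 / 4) :
    fderiv ℝ (coord (ContinuousLinearMap.id ℝ (Matrix n n ℂ)) L M V) 0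
      = fderiv ℝ (coord (ContinuousLinearMap.id ℝ (Matrix n n ℂ)) L M (flatCfg : Site d → Fin d → (Matrix n n ℂ)ˣ)) 0 := by
  have hL : 1 ≤ L := Nat.one_le_iff_ne_zero.mpr (NeZero.ne L)
  ext ψ r κ
  rw [fderiv_coord_apply (ContinuousLinearMap.id ℝ (Matrix n n ℂ)) L M V (fun q κ' r' => by linarith [hW q κ' r']) ψ r κ,
    pushDir_comm hcomm hL V _ _ κ (hW _ κ), fderiv_coord_flatCfg_apply]

/-- **THE MULTI-LEVEL CONSTRAINT DIFFERENTIAL IS BACKGROUND-INDEPENDENT IN THE COMMUTING SECTOR**: `levelQ' L N j V = levelQ' L N j 1` whenever every iterated average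
`(cavg L)^[i] V`, `i ≤ j`, has loop radius `≤ 1/4`. [folklore] -/
theorem levelQ'_comm_eq_flat {L N : ℕ} [NeZero L] [NeZero N] :
    ∀ (j : ℕ) (V : Site d → Fin d → (Matrix n n ℂ)ˣ),
      (∀ i ≤ j, ∀ (q : Site d) (κ : Fin d) (r : Fin d → Fin L),
          ‖((Wcx L ((cavg L)^[i] V) q κ (boxVec L r) : (Matrix n n ℂ)ˣ) : Matrix n n ℂ) - 1‖ ≤ 1 / 4) →
      levelQ' L N j V = levelQ' L N j (flatCfg : Site d → Fin d → (Matrix n n ℂ)ˣ)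
  | 0, V, hV => by
      haveI : NeZero (L * N) := ⟨Nat.mul_ne_zero (NeZero.ne L) (NeZero.ne N)⟩
      show twoLevelQ' L N V = twoLevelQ' L N flatCfg
      rw [twoLevelQ', twoLevelQ', fderiv_coord_comm hcomm V (hV 0 le_rfl)]
  | j + 1, V, hV => by
      haveI : NeZero (L * tower L N j) := ⟨Nat.mul_ne_zero (NeZero.ne L) (tower_ne_zero L N j)⟩
      show (levelQ' L N j (cavg L V)).comp (fderiv ℝ (coord (ContinuousLinearMap.id ℝ (Matrix n n ℂ)) L (L * tower L N j) V) 0)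
        = (levelQ' L N j (cavg L flatCfg)).comp (fderiv ℝ (coord (ContinuousLinearMap.id ℝ (Matrix n n ℂ)) L (L * tower L N j) flatCfg) 0)
      rw [fderiv_coord_comm hcomm V (hV 0 (Nat.zero_le _)), cavg_flatCfg,
        levelQ'_comm_eq_flat j (cavg L V) (fun i hi q κ r => by
          have := hV (i + 1) (by omega) q κ r
          rwa [Function.iterate_succ_apply] at this)]

end Comm

end

end Summit.QuantumFields.BalabanUV.T4Continuum.NE7CommutingPushForward
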